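import Summits.ABC.StewartYu.PadicTwistPMMain
import HarnessLib

/-!
# Cell abc-stewartyu, WP-Y provider B (xiii): adapters exact class ⇒ ± class

`Summits/ABC/StewartYu/PadicTwistPMAdapters.lean` — cell `abc-stewartyu`, seat p3 (crux `W80OneModFour`
stmt-ABC-19487; memo-05). An EXACT class (`TwistSetup.Inv`, p2's invariant) is a ± class with `sgn ≡ 1`
(`InvPM`); hence p2's level-`0` Siegel step on one class (`Siegel`, `PadicTwistSiegel.lean`) discharges the
± chain's `SiegelPM`, and an exact-class endgame contradiction is implied by the ± one. [folklore].
-/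

noncomputable section

open Finset
open Literature.NumberTheory.Transcendental
open Literature.NumberTheory.Transcendental.CW77.Setup (Idx Tau tauNorm)

namespace Summit.ABC.StewartYu

namespace TwistSetup

variable {p : ℕ} [Fact p.Prime] (S : TwistSetup p) {h Lb : ℕ}

/-- **Exact class ⇒ ± class** (`sgn ≡ 1`). [folklore] -/
theorem invPM_of_inv {J₀ : ℕ} {L : Fin S.d → ℕ} {Lθ S₀ T : ℕ} {P : ℤ} {J : ℕ}
    {pv : Idx S.d h Lb → ℤ} (inv : S.Inv J₀ L Lθ S₀ T P J pv) : S.InvPM J₀ L Lθ S₀ T P J pv := by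
  obtain ⟨ρ, hρG, hcls⟩ := inv.cls
  exact ⟨inv.inv, ρ, fun _ => 1, hρG, fun _ _ => Or.inl rfl, fun u hu => by rw [hcls u hu]; simp⟩

/-- **p2's Siegel step on one class discharges `SiegelPM`.** [folklore] -/
theorem siegelPM_of_siegel {J₀ : ℕ} {L : Fin S.d → ℕ} {Lθ S₀ T : ℕ} {P : ℤ}
    (hS : S.Siegel (h := h) (Lb := Lb) J₀ L Lθ S₀ T P) : S.SiegelPM (h := h) (Lb := Lb) J₀ L Lθ S₀ T P := by
  obtain ⟨pv, hinv⟩ := hS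
  exact ⟨pv, S.invPM_of_inv hinv⟩

/-- **`EndgamePM` implies p2's `Endgame`** (an exact-class invariant at the top level is a ± one). [folklore] -/
theorem endgame_of_endgamePM {J₀ : ℕ} {L : Fin S.d → ℕ} {Lθ S₀ T : ℕ} {P : ℤ}
    (hE : S.EndgamePM (h := h) (Lb := Lb) J₀ L Lθ S₀ T P) : S.Endgame (h := h) (Lb := Lb) J₀ L Lθ S₀ T P :=
  fun pv hinv => hE pv (S.invPM_of_inv hinv)

end TwistSetup

end Summit.ABC.StewartYu

end
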